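import Literature.Computability.Complexity.GateEliminationCase6Vars
import Literature.Computability.Complexity.GateEliminationCase54Affine
import Literature.Computability.Complexity.GateEliminationDoomedSharp

/-!
# Gate elimination: leaves of Case 8.2 of Li–Yang's Theorem 4.1

Case 8.2 of §4.1 (ECCC TR21-023, pp. 31–40): `G` is a topologically minimal ∧-type gate fed by
`P` and the ⊕-type gate `Q` of the xor-part, both depending only on protected variables. This
file PROVES the leaves of Case 8.2 that are plain substitution-and-normalization moves:

* `Semicircuit.case8_2_4_2` — Case 8.2.4.2: "one of `P` and `Q`, say `P`, is fed by two
  protected variables `x_j` and `x_k`. By Case 8.2.1, we assume that `x_j` and `x_k` are not a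
  couple. By Case 1, … both `x_j` and `x_k` are `1`-variables. By substituting constant to both
  `x_j` and `x_k`, we can trivialize `P` and `G`, further eliminating `Q` and at least one
  descendant of `G`. During this process, the potential increment is bounded by `3`: zero for
  `P` and `G`, two for `Q` and one for the descendant of `G`. Hence we eliminate four gates,
  kill two quadratic equations and two influential variables, which gives
  `Δμ ≥ (4 - 3α_φ + 2α_I + 2α_Q)/2 ≥ δ` per substitution."

(Case 8.2.1 — the couple case — is `Semicircuit.case8_2_1` in `GateEliminationCase6Vars.lean`.)

## References

* J. Li, T. Yang, *3.1n − o(n) circuit lower bounds for explicit functions*, STOC 2022;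
  ECCC TR21-023, §4.1 (Case 8.2.4.2), Lemma 3.11.
-/

namespace Literature.Computability.Complexity

open Finset

namespace Semicircuit

variable {n : ℕ} {C : Semicircuit n} {f : (Fin n → ZMod 2) → Bool} {R : RdqSource n} {d : ℕ} {αφ αI αQ : ℝ}

/-- **Case 8.2.4.2 of the proof of Thm. 4.1**: the ∧-type gate `G` reads the gate `P` (at `aP`)
and the `1`-gate `Q` of the xor-part; `P` reads two protected variables `x_j`, `x_k` of two
different couples. Two constant substitutions (`x_j`, `x_k`, chosen so that the constant `P`
trivializes `G`), then the eliminations of `P` (`ΔΦ ≤ 0`), `G` (`ΔΦ ≤ 0`), the `0`-gate `Q`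
(Rule 1, `ΔΦ ≤ 2`) and a reader of `G` (`ΔΦ ≤ 1`): `Δμ ≥ 4 - 3α_φ + 2α_I + 2α_Q ≥ 2δ`, `t = 2`.
[cite: LiYang2022, §4.1 (Case 8.2.4.2), Lemma 3.11] -/
theorem case8_2_4_2 (hf : IsAffineDisperser f d) (hd : 2 * d + 2 < R.dim) (hF : C.Fair)
    (hC : C.ComputesRestr f R) (hS : C.Standing R) (hφ : 0 ≤ αφ) (hI : 0 ≤ αI) (αQ : ℝ)
    {G P Q : Fin C.m} {aP b₀ : Fin 2} {j k l l' : Fin n} {e e' : QuadEq n}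
    (hGand : IsAndOp (C.op G)) (hGP : C.arg G aP = .gate P) (hGQ : C.arg G aP.rev = .gate Q)
    (hQK : Q ∈ C.xorPart) (hQ1 : C.fanout (.gate Q) = 1)
    (hPj : C.arg P b₀ = .var j) (hPk : C.arg P b₀.rev = .var k)
    (he : R.quad l = some e) (hej : e.Reads j) (he' : R.quad l' = some e') (hek : e'.Reads k) (hll : l ≠ l') :
    C.StepGoal f R αφ αI αQ := by
  classical
  have hN := hS.normalized.1
  have hjp : R.Protected j := RdqSource.protected_of_reads he hej
  have hkp : R.Protected k := RdqSource.protected_of_reads he' hek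
  have hjk : j ≠ k := ne_of_arg_var hN hPj hPk
  obtain ⟨cP, hcP⟩ := hS.isXorOp_of_protected hjp hPj
  have hPand : ¬ IsAndOp (C.op P) := hS.protected_not_and j hjp P b₀ hPj
  have hQand : ¬ IsAndOp (C.op Q) := fun h => C.not_mem_xorPart_of_isAndOp h hQK
  have hGK : G ∉ C.xorPart := C.not_mem_xorPart_of_isAndOp hGand
  have hGP' : G ≠ P := fun h => hPand (h ▸ hGand)
  have hGQ' : G ≠ Q := fun h => hGK (h ▸ hQK)
  have hPQ : P ≠ Q := by
    intro h
    apply hN.arg_zero_ne_arg_one G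
    rcases fin2_eq_or_eq_rev 0 aP with rfl | h'
    · have h1 : C.arg G 1 = .gate Q := hGQ
      rw [hGP, h1, h]
    · have ha : aP = 1 := h'
      subst ha
      have h0 : C.arg G 0 = .gate Q := hGQ
      rw [h0, hGP, h]
  -- `Q` does not read `G` (xor-part), `P` reads variables: a reader `H` of `G` is a fourth gate
  have hjinf : j ∈ C.influential R := C.mem_influential_of_reads R hPj
  -- the constants: `x_k := 0`, `x_j := bP ⊕ cP`, so that `P ≡ bP` trivializes `G`
  obtain ⟨bP, hbP⟩ := exists_trivializing hGand aP
  let cj' : Bool := bP ^^ cP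
  let cj : ZMod 2 := finTwoEquiv.symm cj'
  have hcj : finTwoEquiv cj = cj' := finTwoEquiv.apply_symm_apply cj'
  let ck : ZMod 2 := finTwoEquiv.symm false
  have hck : finTwoEquiv ck = false := finTwoEquiv.apply_symm_apply false
  -- step 1: `x_j := cj`
  let C₁ := C.substConst j (finTwoEquiv cj)
  let R₁ := RdqSource.assignProtected he hej cj
  have hF₁ : C₁.Fair := hF.substConst j _
  have hC₁ : C₁.ComputesRestr f R₁ := hC.substConst_assignProtected he hej cj
  let P₁ := C.substConstPacking j (finTwoEquiv cj) ∅
  have hP₁ : C₁.IsPacking P₁ := C.isPacking_empty.substConst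
  have hdim₁ : R₁.dim + 1 = R.dim := RdqSource.dim_assignProtected he hej cj
  have hq₁ : R₁.quadCount + 1 = R.quadCount := RdqSource.quadCount_assignProtected he hej cj
  have hμ₁ : C₁.measure αφ αI αQ P₁ R₁ ≤ C.measure αφ αI αQ ∅ R - αI - αQ := by
    have h := C.measure_substConst_le hφ αI αQ C.isPacking_empty R R₁ j (finTwoEquiv cj)
    have h1 := C.influential_substConst_assignProtected_subset he hej cj (finTwoEquiv cj)
    have h2 : C₁.influential R₁ ⊆ (C.influential R).erase j := fun i hi => (mem_filter.mp (h1 hi)).1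
    have h3 := card_le_card h2
    have h4 := card_erase_add_one hjinf
    have hinf : ((C₁.influential R₁).card : ℝ) + 1 ≤ (C.influential R).card := by
      have : (C₁.influential R₁).card + 1 ≤ (C.influential R).card := by omega
      exact_mod_cast this
    have hq' : ((R.quadCount : ℕ) : ℝ) = R₁.quadCount + 1 := by exact_mod_cast hq₁.symm
    rw [hq'] at h
    nlinarith
  -- step 2: `x_k := 0`
  have he'₁ : R₁.quad l' = some e' := by
    rw [RdqSource.assignProtected_quad_of_ne he hej cj (Ne.symm hll)]; exact he'
  let C₂ := C₁.substConst k (finTwoEquiv ck)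
  let R₂ := RdqSource.assignProtected (R := R₁) he'₁ hek ck
  have hF₂ : C₂.Fair := hF₁.substConst k _
  have hC₂ : C₂.ComputesRestr f R₂ := hC₁.substConst_assignProtected he'₁ hek ck
  let P₂ := C₁.substConstPacking k (finTwoEquiv ck) P₁
  have hP₂ : C₂.IsPacking P₂ := hP₁.substConst
  have hdim₂ : R₂.dim + 1 = R₁.dim := RdqSource.dim_assignProtected he'₁ hek ck
  have hq₂ : R₂.quadCount + 1 = R₁.quadCount := RdqSource.quadCount_assignProtected he'₁ hek ck
  have hkp₁ : R₁.Protected k :=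
    (RdqSource.protected_assignProtected_iff he hej cj k).mpr ⟨hkp.1, l', e', Ne.symm hll, he', hek⟩
  have hμ₂ : C₂.measure αφ αI αQ P₂ R₂ ≤ C₁.measure αφ αI αQ P₁ R₁ - αI - αQ := by
    have h := C₁.measure_substConst_le hφ αI αQ hP₁ R₁ R₂ k (finTwoEquiv ck)
    have h1 := C₁.influential_substConst_assignProtected_subset he'₁ hek ck (finTwoEquiv ck)
    have h2 : C₂.influential R₂ ⊆ (C₁.influential R₁).erase k := fun i hi => (mem_filter.mp (h1 hi)).1
    have h3 := card_le_card h2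
    have hkinf : k ∈ C₁.influential R₁ := mem_filter.mpr ⟨mem_univ _, Or.inr hkp₁⟩
    have h4 := card_erase_add_one hkinf
    have hinf : ((C₂.influential R₂).card : ℝ) + 1 ≤ (C₁.influential R₁).card := by
      have : (C₂.influential R₂).card + 1 ≤ (C₁.influential R₁).card := by omega
      exact_mod_cast this
    have hq' : ((R₁.quadCount : ℕ) : ℝ) = R₂.quadCount + 1 := by exact_mod_cast hq₂.symm
    rw [hq'] at h
    nlinarith
  have hd₂ : 2 * d + 1 ≤ R₂.dim := by
    have h1 : R₂.dim + 1 = R₁.dim := hdim₂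
    have h2 : R₁.dim + 1 = R.dim := hdim₁
    omega
  -- wires of `C₂`
  have hPj₂ : C₂.arg P b₀ = .const cj' := by
    show ((C.arg P b₀).substConst j (finTwoEquiv cj)).substConst k (finTwoEquiv ck) = _
    rw [hPj, Node.substConst_var_self, hcj]; rfl
  have hPk₂ : C₂.arg P b₀.rev = .const false := by
    show ((C.arg P b₀.rev).substConst j (finTwoEquiv cj)).substConst k (finTwoEquiv ck) = _
    rw [hPk, Node.substConst_var_of_ne hjk.symm, Node.substConst_var_self, hck]
  have hGP₂ : C₂.arg G aP = .gate P := by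
    show ((C.arg G aP).substConst j _).substConst k _ = _; rw [hGP]; rfl
  have hGQ₂ : C₂.arg G aP.rev = .gate Q := by
    show ((C.arg G aP.rev).substConst j _).substConst k _ = _; rw [hGQ]; rfl
  have hgate₂ : ∀ {g : Fin C.m} {a : Fin 2} {g' : Fin C.m}, C₂.arg g a = .gate g' ↔ C.arg g a = .gate g' := by
    intro g a g'
    show ((C.arg g a).substConst j _).substConst k _ = .gate g' ↔ _
    rw [Node.substConst_eq_gate_iff, Node.substConst_eq_gate_iff]
  -- step 3: `P` computes the constant `bP`; replace it (no troubled gate is caused: its wires are constants)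
  have hid : ∀ (x : Fin n → Bool) (w : Fin C₂.m → Bool),
      C₂.op P (C₂.nodeVal x w (C₂.arg P 0)) (C₂.nodeVal x w (C₂.arg P 1)) = bP := by
    intro x w
    show C.op P _ _ = bP
    rcases fin2_eq_or_eq_rev 0 b₀ with h0 | h1
    · have e0 : C₂.arg P 0 = .const cj' := by rw [h0] at hPj₂; exact hPj₂
      have e1 : C₂.arg P 1 = .const false := by rw [h0] at hPk₂; exact hPk₂
      rw [e0, e1, hcP]
      show ((cj' ^^ false) ^^ cP) = bP
      cases bP <;> cases cP <;> rfl
    · have hb : b₀ = 1 := h1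
      have e1 : C₂.arg P 1 = .const cj' := by rw [hb] at hPj₂; exact hPj₂
      have e0 : C₂.arg P 0 = .const false := by rw [hb] at hPk₂; exact hPk₂
      rw [e0, e1, hcP]
      show ((false ^^ cj') ^^ cP) = bP
      cases bP <;> cases cP <;> rfl
  have hselfP : ∀ a, C₂.arg P a ≠ .gate P := by
    intro a h
    rcases fin2_eq_or_eq_rev b₀ a with rfl | rfl
    · rw [hPj₂] at h; cases h
    · rw [hPk₂] at h; cases h
  have houtP : C₂.out ≠ .gate P := out_ne_of_const_const hf (by omega) hF₂ hC₂ hPj₂ hPk₂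
  let E₁ := elimDataWRedirectConst hF₂ hC₂ hP₂ bP hid (Or.inr ⟨b₀, cj', hPj₂⟩) hselfP houtP hφ hI αQ
  have hrepl₁ : E₁.repl = .const bP := rfl
  have hnonew₁ : ∀ k', E₁.C'.Troubled k' → ¬ C₂.Troubled (E₁.ι k') → False := by
    intro k' hT' hT
    obtain ⟨a, ha⟩ := E₁.causedBy_of_new_troubled k' hT' hT
    rcases fin2_eq_or_eq_rev b₀ a with rfl | rfl
    · rw [hPj₂] at ha; exact not_causedBy_const ha
    · rw [hPk₂] at ha; exact not_causedBy_const ha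
  obtain ⟨P₃, hP₃, hpot₃⟩ := E₁.exists_packing_of_cover hP₂ ∅ ∅ (fun k' hT' hT => (hnonew₁ k' hT' hT).elim)
    (Or.inl (by simp)) (Or.inl (by simp))
  simp only [if_true, Nat.cast_zero, add_zero] at hpot₃
  have hopE₁ : ∀ k', E₁.C'.op k' = C.op (E₁.ι k') := fun k' => elimDataWRedirectConst_op hF₂ hC₂ hP₂ bP hid _ hselfP houtP hφ hI αQ k'
  -- `G` in `E₁.C'`: reads the constant `bP` and `Q`, trivialized
  obtain ⟨kG, hkG⟩ := E₁.ι_surj G hGP'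
  obtain ⟨kQ, hkQ⟩ := E₁.ι_surj Q hPQ.symm
  have hkGc : E₁.C'.arg kG aP = .const bP :=
    (E₁.arg_eq_const_iff kG aP bP).mpr (Or.inr ⟨by rw [hkG]; exact hGP₂, hrepl₁⟩)
  have hkGQ : E₁.C'.arg kG aP.rev = .gate kQ := by
    rw [E₁.arg_eq_gate_iff, hkG, hkQ]; exact Or.inl hGQ₂
  have htriv : E₁.C'.liveFn kG aP bP false = E₁.C'.liveFn kG aP bP true := by
    unfold liveFn at hbP ⊢
    rw [hopE₁ kG, hkG]
    exact hbP
  have houtG : E₁.C'.out ≠ .gate kG := out_ne_of_trivialized hf (by omega) E₁.fair E₁.computes hkGc htriv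
  -- step 4: eliminate `G` (no troubled gate is caused: its wires are a constant and the ⊕-type `Q`)
  let E₂ := elimDataWTriv E₁.fair E₁.computes hP₃ hkGc htriv houtG hφ hI αQ
  have hrepl₂ : E₂.repl = .const (E₁.C'.liveFn kG aP bP false) := rfl
  have hnonew₂ : ∀ k', E₂.C'.Troubled k' → ¬ E₁.C'.Troubled (E₂.ι k') → False := by
    intro k' hT' hT
    obtain ⟨a, ha⟩ := E₂.causedBy_of_new_troubled k' hT' hT
    rcases fin2_eq_or_eq_rev aP a with rfl | rfl
    · rw [hkGc] at ha; exact not_causedBy_const ha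
    · rw [hkGQ] at ha
      rcases ha with ha | ⟨z, hz, -⟩
      · have hι : E₂.ι k' = kQ := (Node.gate.inj ha).symm
        obtain ⟨hand', -⟩ := hT'
        rw [E₂.isAndOp_iff, hι, hopE₁ kQ, hkQ] at hand'
        exact hQand hand'
      · cases hz
  obtain ⟨P₄, hP₄, hpot₄⟩ := E₂.exists_packing_of_cover hP₃ ∅ ∅ (fun k' hT' hT => (hnonew₂ k' hT' hT).elim)
    (Or.inl (by simp)) (Or.inl (by simp))
  simp only [if_true, Nat.cast_zero, add_zero] at hpot₄
  -- `Q` in `E₂.C'`: a `0`-gate of the xor-part, hence not the output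
  obtain ⟨kQ₂, hkQ₂⟩ := E₂.ι_surj kQ (fun h => hGQ' (by rw [← hkG, ← hkQ, h]))
  have hQ1' : E₁.C'.fanout (.gate kQ) = 1 := by
    have h := E₁.fanout_gate_add (k' := kQ) (by rw [hrepl₁]; exact fun h => by cases h)
    rw [hkQ] at h
    have h0 : (univ.filter fun a : Fin 2 => C₂.arg P a = .gate Q).card = 0 := by
      rw [card_eq_zero, filter_eq_empty_iff]
      intro a _ ha
      rcases fin2_eq_or_eq_rev b₀ a with rfl | rfl
      · rw [hPj₂] at ha; cases ha
      · rw [hPk₂] at ha; cases ha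
    have h2 : C₂.fanout (.gate Q) = 1 := by
      show ((C.substConst j (finTwoEquiv cj)).substConst k (finTwoEquiv ck)).fanout (.gate Q) = 1
      rw [(C.substConst j (finTwoEquiv cj)).fanout_substConst_gate, C.fanout_substConst_gate]; exact hQ1
    rw [h0, h2] at h
    omega
  have hQ0 : E₂.C'.fanout (.gate kQ₂) = 0 := by
    have h := E₂.fanout_gate_add (k' := kQ₂) (by rw [hrepl₂]; exact fun h => by cases h)
    rw [hkQ₂, hQ1'] at h
    have h3 : 1 ≤ (univ.filter fun a : Fin 2 => E₁.C'.arg kG a = .gate kQ).card :=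
      card_pos.mpr ⟨aP.rev, mem_filter.mpr ⟨mem_univ _, hkGQ⟩⟩
    omega
  have hkQ₂K : kQ₂ ∈ E₂.C'.xorPart := by
    rw [E₂.mem_xorPart_iff, hkQ₂, E₁.mem_xorPart_iff, hkQ]; exact hQK
  have houtQ : E₂.C'.out ≠ .gate kQ₂ := out_ne_gate_of_mem_xorPart hf (by omega) E₂.fair E₂.computes hkQ₂K
  -- step 5: delete the `0`-gate `Q` (Rule 1, `ΔΦ ≤ 2`)
  have hno : ∀ k' a, E₂.C'.arg k' a ≠ .gate kQ₂ := (fanout_eq_zero_iff _ _).mp hQ0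
  let ε₃ := E₂.C'.skipEquiv kQ₂
  obtain ⟨P₅, hF₅, hC₅, hP₅, hm₅, hμ₅⟩ :=
    E₂.C'.measure_removeGate_le kQ₂ ε₃ E₂.fair E₂.computes hP₄ hno houtQ hφ hI αQ
  set C₅ := E₂.C'.removeGate kQ₂ ε₃ with hC₅def
  have hcard : ((((univ : Finset (Fin 2)).filter fun a => ∀ b, E₂.C'.arg kQ₂ a ≠ .const b).card : ℕ) : ℝ) ≤ 2 := by
    have := card_filter_le (univ : Finset (Fin 2)) (fun a => ∀ b, E₂.C'.arg kQ₂ a ≠ .const b)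
    rw [card_univ, Fintype.card_fin] at this
    exact_mod_cast this
  -- step 6: a reader `H` of `G` is fed by a constant in `C₅`: one more doomed gate
  have hGout : C.out ≠ .gate G := by
    intro hCo
    apply houtG
    have h1 := E₁.out_eq
    rw [if_neg houtP] at h1
    apply E₁.embed_injective
    show E₁.C'.out.embed E₁.ι = (Node.gate kG : Node n _).embed E₁.ι
    rw [h1]
    show C₂.out = Node.gate (E₁.ι kG)
    rw [hkG]
    show (C.out.substConst j _).substConst k _ = _
    rw [hCo]; rfl
  have hGpos : 0 < C.fanout (.gate G) := by
    by_contra h0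
    push Not at h0
    exact hGout (hN.out_of_fanout_eq_zero G (Nat.le_zero.mp h0))
  obtain ⟨H, aH, hHG⟩ := exists_reader_of_fanout_pos hGpos
  have hHG' : H ≠ G := fun h => by rw [h] at hHG; exact C.arg_ne_self_of_not_mem hGK aH hHG
  have hHP : H ≠ P := by
    intro h; rw [h] at hHG
    rcases fin2_eq_or_eq_rev b₀ aH with h' | h'
    · rw [h', hPj] at hHG; cases hHG
    · rw [h', hPk] at hHG; cases hHG
  have hHQ : H ≠ Q := fun h => hGK (C.mem_of_arg_eq Q hQK aH G (h ▸ hHG))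
  obtain ⟨kH, hkH⟩ := E₁.ι_surj H hHP
  have hkHG : kH ≠ kG := fun h => hHG' (by rw [← hkH, ← hkG, h])
  obtain ⟨kH₂, hkH₂⟩ := E₂.ι_surj kH hkHG
  have hkHQ : kH₂ ≠ kQ₂ := by
    intro h
    have := congrArg E₂.ι h; rw [hkH₂, hkQ₂] at this
    have := congrArg E₁.ι this; rw [hkH, hkQ] at this
    exact hHQ this
  have hH₁G : E₁.C'.arg kH aH = .gate kG := by
    rw [E₁.arg_eq_gate_iff, hkH, hkG]; exact Or.inl (hgate₂.mpr hHG)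
  have hH₂c : E₂.C'.arg kH₂ aH = .const (E₁.C'.liveFn kG aP bP false) :=
    (E₂.arg_eq_const_iff kH₂ aH _).mpr (Or.inr ⟨by rw [hkH₂]; exact hH₁G, hrepl₂⟩)
  have hdoomed : 1 ≤ C₅.doomed.card := by
    refine card_pos.mpr ⟨ε₃.symm ⟨kH₂, hkHQ⟩, C₅.mem_doomed_of_const (a := aH) (c := E₁.C'.liveFn kG aP bP false) ?_⟩
    show (E₂.C'.arg (ε₃ (ε₃.symm ⟨kH₂, hkHQ⟩)) aH).skip kQ₂ ε₃ = .const _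
    rw [Equiv.apply_symm_apply]
    show (E₂.C'.arg kH₂ aH).skip kQ₂ ε₃ = .const _
    rw [hH₂c]; rfl
  obtain ⟨D', P', hF', hCD', hP', hm', hμ'⟩ :=
    cascade_doomed' hf hd₂ hφ hI αQ 1 C₅ P₅ hF₅ hC₅ hP₅ hdoomed
  -- accounting
  have hdimt : R₂.dim + 2 = R.dim := by
    have h1 : R₂.dim + 1 = R₁.dim := hdim₂
    have h2 : R₁.dim + 1 = R.dim := hdim₁
    omega
  refine Or.inr ⟨2, by norm_num, by norm_num, D', R₂, P', hF', hCD', hP', hdimt, ?_⟩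
  have hδ := liYangDelta_le_case1 αφ αI αQ
  -- `μ(E₁.C', P₃) ≤ μ(C₂, P₂) - 1`, `μ(E₂.C', P₄) ≤ μ(E₁.C', P₃) - 1`
  have hinfE₁ : ((E₁.C'.influential R₂).card : ℝ) ≤ (C₂.influential R₂).card := by
    exact_mod_cast card_le_card (E₁.influential_subset R₂)
  have hinfE₂ : ((E₂.C'.influential R₂).card : ℝ) ≤ (E₁.C'.influential R₂).card := by
    exact_mod_cast card_le_card (E₂.influential_subset R₂)
  have hmE₁ : ((E₁.C'.m : ℕ) : ℝ) + 1 = C₂.m := by exact_mod_cast E₁.m_add_one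
  have hmE₂ : ((E₂.C'.m : ℕ) : ℝ) + 1 = E₁.C'.m := by exact_mod_cast E₂.m_add_one
  have hμE₁ : E₁.C'.measure αφ αI αQ P₃ R₂ ≤ C₂.measure αφ αI αQ P₂ R₂ - 1 := by
    unfold measure
    nlinarith [mul_le_mul_of_nonneg_left hinfE₁ hI, mul_le_mul_of_nonneg_left hpot₃ hφ]
  have hμE₂ : E₂.C'.measure αφ αI αQ P₄ R₂ ≤ E₁.C'.measure αφ αI αQ P₃ R₂ - 1 := by
    unfold measure
    nlinarith [mul_le_mul_of_nonneg_left hinfE₂ hI, mul_le_mul_of_nonneg_left hpot₄ hφ]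
  push_cast at hμ' ⊢
  nlinarith [mul_le_mul_of_nonneg_left hcard hφ]

end Semicircuit

end Literature.Computability.Complexity
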